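import Summits.Ventures.PackingBounds.Configurations.DesignSlackness
import Summits.Ventures.PackingBounds.Kissing.DimensionEightRigidity
import Summits.Ventures.PackingBounds.Kissing.DimensionEightDesign

/-!
# Rigidity of `240`-point kissing configurations in `ℝ⁸`: distance-regularity and energy

Framing: lottery ticket; floor = certified bounds/negative ranges. Venture `PackingBounds` (cell
`pub-packcert`, seat `pub-packcert-energy`).

Let `C ⊂ S⁷` be ANY kissing configuration (pairwise inner products `≤ 1/2`) with `|C| = 240`. Complementary
slackness for the sharp Delsarte certificate (tree: `Kissing.kissing_dim8_inner_of_card_eq_240`,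
`Kissing.kissing_dim8_moments_of_card_eq_240`) puts all inner products of distinct points in
`{-1, -1/2, 0, 1/2}` and kills the Gegenbauer moments of orders `1…6`; by the weighted slackness of
`Configurations/DesignSlackness.lean` the moments vanish around every point, and the four neighbour counts of
each `x ∈ C` solve a nonsingular `4 × 4` system: **every point has exactly `56` neighbours at `60°`, `126`
orthogonal points, `56` at `120°` and one antipode** (`nbrCount8_eq`) — `C` is distance-regular with the
parameters of the `E₈` root system (Bannai–Sloane 1981, the input of their uniqueness theorem for `κ(8)`).
Consequently the `a`-energy of every such `C` is `240 (a(-1) + 56 a(-1/2) + 126 a(0) + 56 a(1/2))`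
for every pair potential `a` (`energy8_eq_of_card_eq_240`).

## References
* E. Bannai, N. J. A. Sloane, Canad. J. Math. 33 (1981) 437–449 (= Conway–Sloane, *SPLAG*, Ch. 14). [`ConwaySloane1999`]
-/

namespace Summit.Ventures.PackingBounds.Config.E8Design

open Finset Literature.Analysis.SpecialFunctions Literature.Geometry.DiscreteGeometry

local notation "E8" => EuclideanSpace ℝ (Fin 8)

/-- Number of points of `C` other than `x` with inner product `t` with `x`. -/
noncomputable def nbrCount8 (C : Finset E8) (x : E8) (t : ℝ) : ℕ :=
  ((C.erase x).filter fun y => inner ℝ x y = t).card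

/-- The four inner products of distinct `E₈` roots (normalised). -/
noncomputable def T4 : Finset ℝ := {-1, -1 / 2, 0, 1 / 2}

/-- A sum over `T4`, written out. -/
theorem sum_T4 (F : ℝ → ℝ) : ∑ t ∈ T4, F t = F (-1) + F (-1 / 2) + F 0 + F (1 / 2) := by
  simp only [T4]
  rw [sum_insert (by norm_num), sum_insert (by norm_num), sum_insert (by norm_num), sum_singleton]
  ring

/-- `C_1^{(3)}` explicitly. -/
theorem gegenbauerSum_3_1 (t : ℝ) : gegenbauerSum 3 1 t = 6 * t := by
  simp [gegenbauerSum, gegenbauerCoeff, Nat.factorial]; ring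

/-- `C_2^{(3)}` explicitly. -/
theorem gegenbauerSum_3_2 (t : ℝ) : gegenbauerSum 3 2 t = 24 * t ^ 2 - 3 := by
  simp [gegenbauerSum, gegenbauerCoeff, Finset.sum_range_succ, Finset.prod_range_succ, Nat.factorial]; ring

/-- `C_3^{(3)}` explicitly. -/
theorem gegenbauerSum_3_3 (t : ℝ) : gegenbauerSum 3 3 t = 80 * t ^ 3 - 24 * t := by
  simp [gegenbauerSum, gegenbauerCoeff, Finset.sum_range_succ, Finset.prod_range_succ, Nat.factorial]; ring

section perpoint

variable {C : Finset E8} (h1 : ∀ x ∈ C, ‖x‖ = 1)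
  (h2 : ∀ x ∈ C, ∀ y ∈ C, x ≠ y → inner ℝ x y ≤ 1 / 2) (hcard : C.card = 240)
include h1 h2 hcard

/-- **Per-point design property** of a `240`-point kissing configuration in `ℝ⁸`:
`Σ_{y ∈ C} C_k^{(3)}(⟨x, y⟩) = 0` for every `x ∈ C`, `1 ≤ k ≤ 6`. [cite: ConwaySloane1999, Ch. 14 §3] -/
theorem pointMoment8_eq_zero {k : ℕ} (hk1 : 1 ≤ k) (hk2 : k ≤ 6) {x : E8} (hx : x ∈ C) :
    ∑ y ∈ C, gegenbauerSum (3 : ℝ) k (inner ℝ x y) = 0 :=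
  DesignSlackness.pointMoment_eq_zero_of_total (n := 8) (μ := 3) (by norm_num) (by norm_num) C h1 k
    (Kissing.kissing_dim8_moments_of_card_eq_240 C h1 h2 hcard hk1 hk2) hx

/-- Per-point off-diagonal moments. -/
theorem pointMoment8_erase {k : ℕ} (hk1 : 1 ≤ k) (hk2 : k ≤ 6) {x : E8} (hx : x ∈ C) :
    ∑ y ∈ C.erase x, gegenbauerSum (3 : ℝ) k (inner ℝ x y) = -gegenbauerSum 3 k 1 := by
  have h := pointMoment8_eq_zero h1 h2 hcard hk1 hk2 hx
  rw [← Finset.add_sum_erase C _ hx, real_inner_self_eq_norm_sq, h1 x hx, one_pow] at h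
  linarith

/-- Every sum over the other points is a combination of the four neighbour counts. -/
theorem sum_erase_eq_sum_nbrCount8 (g : ℝ → ℝ) {x : E8} (hx : x ∈ C) :
    ∑ y ∈ C.erase x, g (inner ℝ x y) = ∑ t ∈ T4, (nbrCount8 C x t : ℝ) * g t := by
  have hmaps : ∀ y ∈ C.erase x, inner ℝ x y ∈ T4 := by
    intro y hy
    obtain ⟨hne, hyC⟩ := Finset.mem_erase.mp hy
    have h := Kissing.kissing_dim8_inner_of_card_eq_240 C h1 h2 hcard hx hyC (Ne.symm hne)
    simp only [T4, mem_insert, mem_singleton]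
    rcases h with h | h | h | h <;> simp [h]
  rw [← Finset.sum_fiberwise_of_maps_to hmaps]
  refine Finset.sum_congr rfl fun t _ => ?_
  rw [nbrCount8, ← nsmul_eq_mul, ← Finset.sum_const]
  exact Finset.sum_congr rfl fun y hy => by rw [(Finset.mem_filter.mp hy).2]

/-- **Distance-regularity of `240`-point kissing configurations in `ℝ⁸`**: every point has exactly
`1, 56, 126, 56` other points at inner product `-1, -1/2, 0, 1/2` (the `E₈` parameters).
[cite: ConwaySloane1999, Ch. 14 Thm. 3] -/
theorem nbrCount8_eq {x : E8} (hx : x ∈ C) :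
    nbrCount8 C x (-1) = 1 ∧ nbrCount8 C x (-1 / 2) = 56 ∧ nbrCount8 C x 0 = 126 ∧ nbrCount8 C x (1 / 2) = 56 := by
  have e0 := sum_erase_eq_sum_nbrCount8 h1 h2 hcard (fun _ => (1 : ℝ)) hx
  have e0' : ∑ y ∈ C.erase x, (fun _ => (1 : ℝ)) (inner ℝ x y) = 239 := by
    rw [Finset.sum_const, Finset.card_erase_of_mem hx, hcard]; norm_num
  have e1 := sum_erase_eq_sum_nbrCount8 h1 h2 hcard (gegenbauerSum 3 1) hx
  have e2 := sum_erase_eq_sum_nbrCount8 h1 h2 hcard (gegenbauerSum 3 2) hx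
  have e3 := sum_erase_eq_sum_nbrCount8 h1 h2 hcard (gegenbauerSum 3 3) hx
  rw [pointMoment8_erase h1 h2 hcard (by norm_num) (by norm_num) hx] at e1 e2 e3
  rw [e0'] at e0
  rw [sum_T4] at e0 e1 e2 e3
  simp only [gegenbauerSum_3_1, gegenbauerSum_3_2, gegenbauerSum_3_3] at e1 e2 e3
  set a := (nbrCount8 C x (-1) : ℝ) with ha
  set b := (nbrCount8 C x (-1 / 2) : ℝ) with hb
  set c := (nbrCount8 C x 0 : ℝ) with hc
  set d := (nbrCount8 C x (1 / 2) : ℝ) with hd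
  norm_num at e0 e1 e2 e3
  have ra : a = 1 := by
    linear_combination (1 / 90) * e1 + (1 / 60) * e3
  have rb : b = 56 := by
    linear_combination (-1 / 4) * e0 + (2 / 15) * e1 + (-1 / 12) * e2 + (-1 / 20) * e3
  have rc : c = 126 := by
    linear_combination (-1 / 2) * e0 + (1 / 30) * e1 + (1 / 6) * e2 + (1 / 20) * e3
  have rd : d = 56 := by
    linear_combination (-1 / 4) * e0 + (-8 / 45) * e1 + (-1 / 12) * e2 + (-1 / 60) * e3
  rw [ha] at ra; rw [hb] at rb; rw [hc] at rc; rw [hd] at rd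
  exact ⟨by exact_mod_cast ra, by exact_mod_cast rb, by exact_mod_cast rc, by exact_mod_cast rd⟩

/-- **The energy of every `240`-point kissing configuration in `ℝ⁸` is the `E₈` energy**, for every pair
potential `a`. [cite: ConwaySloane1999, Ch. 14 Thm. 3] -/
theorem energy8_eq_of_card_eq_240 (a : ℝ → ℝ) :
    ∑ x ∈ C, ∑ y ∈ C.erase x, a (inner ℝ x y) = 240 * (a (-1) + 56 * a (-1 / 2) + 126 * a 0 + 56 * a (1 / 2)) := by
  have hx : ∀ x ∈ C, ∑ y ∈ C.erase x, a (inner ℝ x y) = a (-1) + 56 * a (-1 / 2) + 126 * a 0 + 56 * a (1 / 2) := by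
    intro x hx
    rw [sum_erase_eq_sum_nbrCount8 h1 h2 hcard a hx, sum_T4]
    obtain ⟨c1, c2, c3, c4⟩ := nbrCount8_eq h1 h2 hcard hx
    rw [c1, c2, c3, c4]
    push_cast
    ring
  rw [Finset.sum_congr rfl hx, Finset.sum_const, hcard, nsmul_eq_mul]
  norm_num

end perpoint

end Summit.Ventures.PackingBounds.Config.E8Design
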